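import Mathlib
import Summits.KontsevichZagierPeriods.Zeta5Search.Families.DualQPolynomial
import Summits.KontsevichZagierPeriods.Zeta5Search.Families.DualGapSeries
import HarnessLib
import HarnessLib.Audit

/-!
# ζ(5) search — Families: CONJECTURE D-exact in twelve parameters — the `Q`-side coefficient `G(e,t)` equals the
# extended dual constant term `Phi(e,t)`, by induction, MODULO the base identity `Phi(0,t) = [t = 0]`

HONEST FRAMING: systematic search; no irrationality claim unless certified.  Cell `pub-zeta5`, certifier 2
(cert-2 g8, 2026-08-22).  Identities between integers; ONE internally minted statement (`DualBaseIdentity`, tagged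
`@[conjecture]`, exact evidence below) is used as a HYPOTHESIS and nothing in the tree treats it as proved; nothing about
`ζ(5)`; no number of record moves.

WHAT.  `Families/DualQPolynomial` has `G(e,t) = [x^t] ∏ F_i^{e_i}` (`e ∈ ℕ⁷`, `t ∈ ℤ⁵`) and its seven Pascal relations;
`Families/DualGapSeries` has the unit products `E(n) = ∏_S u_S^{n_S}` (`n ∈ ℤ¹⁰`) in `ℤ[[r₁..r₅]]` and the seven Plücker
moves.  Here:
* `nExp e t ∈ ℤ¹⁰`, `cExp e t ∈ ℤ⁵` — the span exponents and the target `r`-exponent of Brown–Zudilin's (10)-integrand in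
  the dual gap chart as AFFINE functions of `(e,t)` (cert-2 g8, `HOME/cert-2/g8/DEXACT12.md` §2: `n01 = e₅+e₇−t₂−t₃`,
  `n012 = e₃`, `n0123 = e₁+t₁+t₂−e₂−e₃`, `n12 = e₇`, `n12345 = e₅`, `n23 = t₃−t₄−e₁+e₃`, `n234 = e₄`,
  `n2345 = t₄+t₅+e₁−e₄−e₅`, `n45 = e₄+e₆−t₁−t₃`, `n012345 = t₃+e₂−e₁−t₅`; `c = (t₁, t₁+e₅+e₇−t₅, t₁+t₂+t₃, t₁+t₃, t₄)`);
* **`Phi e t := [r^{cExp e t}] E(nExp e t)`** — the dual constant term EXTENDED to all `(e,t) ∈ ℕ⁷ × ℤ⁵` (negative span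
  exponents allowed; on the region `nExp ≥ 0` it is the honest polynomial coefficient `[g^B] ∏ L_S^{n_S}` and on
  Brown–Zudilin's 8-parameter family it is P2 g6's `dualConstantTerm` — bridges filed separately);
* `Phi_succ0 … Phi_succ6` — `Phi` satisfies EXACTLY the seven Pascal relations of `G` (each = one Plücker move + bookkeeping);
* `DualBaseIdentity` (`@[conjecture]`, INTERNALLY MINTED): `Phi(0,t) = [t = 0]` for all `t ∈ ℤ⁵` — the monomial case of the
  change of variables `z = L45/L0123, z' = g₃L01/(g₂L0123), v = L01L45/(L23L012345), y = g₅L23/(g₄L2345),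
  y' = g₁L012345/(g₀L2345)` (log-Jacobian ≡ 1); exact evidence: `t ∈ [−2,2]⁵` all 3125 values (seven expansion orders), and
  the full identity `G = Phi` at 1200 random `(e,t)`, `e ≤ 4`, `t ∈ [−3,5]` (`HOME/cert-2/g8/code/e5*.py`);
* **`G_eq_Phi_of_base : DualBaseIdentity → ∀ e t, G e t = Phi e t`** — strong induction on `mu(e) = e₁+⋯+e₅+3e₆+3e₇`
  (every Pascal move lowers `mu`; no region bookkeeping is needed because `Phi` is defined everywhere).
So CONJECTURE D-exact in its 12-parameter form is REDUCED to the 5-parameter base identity.  Standard axioms only.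
-/

noncomputable section

open MvPowerSeries Finset

namespace Summit.KontsevichZagierPeriods.Zeta5Search.Families.Cellular

namespace DualR

open DualQ (G tUnit)

/-- The ten span exponents of the dual integrand as affine functions of `(e,t)` (span order `01, 012, 0123, 12, 12345,
23, 234, 2345, 45, 012345`). -/
def nExp (e : Fin 7 → ℕ) (t : Fin 5 → ℤ) : Fin 10 → ℤ :=
  ![(e 4 : ℤ) + e 6 - t 1 - t 2, e 2, (e 0 : ℤ) + t 0 + t 1 - e 1 - e 2, e 6, e 4, t 2 - t 3 - e 0 + e 2, e 3,
    t 3 + t 4 + e 0 - e 3 - e 4, (e 3 : ℤ) + e 5 - t 0 - t 2, t 2 + e 1 - e 0 - t 4]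

/-- The target `r`-exponent `c(e,t) = (t₁, t₁+e₅+e₇−t₅, t₁+t₂+t₃, t₁+t₃, t₄)`. -/
def cExp (e : Fin 7 → ℕ) (t : Fin 5 → ℤ) : Fin 5 → ℤ :=
  ![t 0, t 0 + e 4 + e 6 - t 4, t 0 + t 1 + t 2, t 0 + t 2, t 3]

/-- **The extended dual constant term** `Phi(e,t) = [r^{c(e,t)}] ∏_S u_S^{n_S(e,t)}`. -/
def Phi (e : Fin 7 → ℕ) (t : Fin 5 → ℤ) : ℤ := coeffZ (cExp e t) (E (nExp e t) : S5)

/-! ## Bookkeeping of the affine maps under the moves -/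

section bookkeeping

variable (e : Fin 7 → ℕ) (t : Fin 5 → ℤ)

/-- Move 1 exponents: `n(e+u₁,t) = (n(e,t) − δ23 − δ012345) + δ0123 + δ2345`. -/
theorem nExp_succ0 : nExp (Function.update e 0 (e 0 + 1)) t = (nExp e t - delta 5 - delta 9) + delta 2 + delta 7 := by
  ext k; simp only [Pi.add_apply, Pi.sub_apply]; fin_cases k <;> simp [nExp, delta] <;> omega

/-- Move 1, second child: `n(e, t − u₃) = (n(e,t) − δ23 − δ012345) + δ01 + δ45`. -/
theorem nExp_sub0 : nExp e (t - tUnit 2) = (nExp e t - delta 5 - delta 9) + delta 0 + delta 8 := by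
  ext k; simp only [Pi.add_apply, Pi.sub_apply]; fin_cases k <;> simp [nExp, delta, tUnit] <;> omega

/-- Move 1 targets. -/
theorem cExp_succ0 : cExp (Function.update e 0 (e 0 + 1)) t = cExp e t := by
  ext k; fin_cases k <;> simp [cExp]

/-- Move 1 targets, second child. -/
theorem cExp_sub0 : cExp e (t - tUnit 2) = cExp e t - cUnit 2 - cUnit 3 := by
  ext k; simp only [Pi.sub_apply]; fin_cases k <;> simp [cExp, tUnit, cUnit] <;> omega

/-- Move 2 exponents. -/
theorem nExp_succ1 : nExp (Function.update e 1 (e 1 + 1)) t = (nExp e t - delta 2) + delta 9 := by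
  ext k; simp only [Pi.add_apply, Pi.sub_apply]; fin_cases k <;> simp [nExp, delta] <;> omega

/-- Move 2, second child. -/
theorem nExp_sub1 : nExp e (t - tUnit 0) = (nExp e t - delta 2) + delta 8 := by
  ext k; simp only [Pi.add_apply, Pi.sub_apply]; fin_cases k <;> simp [nExp, delta, tUnit] <;> omega

/-- Move 2 targets. -/
theorem cExp_succ1 : cExp (Function.update e 1 (e 1 + 1)) t = cExp e t := by
  ext k; fin_cases k <;> simp [cExp]

/-- Move 2 targets, second child. -/
theorem cExp_sub1 : cExp e (t - tUnit 0) = cExp e t - cUnit 0 - cUnit 1 - cUnit 2 - cUnit 3 := by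
  ext k; simp only [Pi.sub_apply]; fin_cases k <;> simp [cExp, tUnit, cUnit] <;> omega

/-- Move 3 exponents. -/
theorem nExp_succ2 : nExp (Function.update e 2 (e 2 + 1)) t = (nExp e t - delta 2) + delta 1 + delta 5 := by
  ext k; simp only [Pi.add_apply, Pi.sub_apply]; fin_cases k <;> simp [nExp, delta] <;> omega

/-- Move 3, second child. -/
theorem nExp_sub2 : nExp e (t - tUnit 1) = (nExp e t - delta 2) + delta 0 := by
  ext k; simp only [Pi.add_apply, Pi.sub_apply]; fin_cases k <;> simp [nExp, delta, tUnit] <;> omega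

/-- Move 3 targets. -/
theorem cExp_succ2 : cExp (Function.update e 2 (e 2 + 1)) t = cExp e t := by
  ext k; fin_cases k <;> simp [cExp]

/-- Move 3 targets, second child. -/
theorem cExp_sub2 : cExp e (t - tUnit 1) = cExp e t - cUnit 2 := by
  ext k; simp only [Pi.sub_apply]; fin_cases k <;> simp [cExp, tUnit, cUnit]; omega

/-- Move 4 exponents. -/
theorem nExp_succ3 : nExp (Function.update e 3 (e 3 + 1)) t = (nExp e t - delta 7) + delta 6 + delta 8 := by
  ext k; simp only [Pi.add_apply, Pi.sub_apply]; fin_cases k <;> simp [nExp, delta] <;> omega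

/-- Move 4, second child. -/
theorem nExp_sub3 : nExp e (t - tUnit 3) = (nExp e t - delta 7) + delta 5 := by
  ext k; simp only [Pi.add_apply, Pi.sub_apply]; fin_cases k <;> simp [nExp, delta, tUnit] <;> omega

/-- Move 4 targets. -/
theorem cExp_succ3 : cExp (Function.update e 3 (e 3 + 1)) t = cExp e t := by
  ext k; fin_cases k <;> simp [cExp]

/-- Move 4 targets, second child. -/
theorem cExp_sub3 : cExp e (t - tUnit 3) = cExp e t - cUnit 4 := by
  ext k; simp only [Pi.sub_apply]; fin_cases k <;> simp [cExp, tUnit, cUnit]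

/-- Move 5 exponents. -/
theorem nExp_succ4 : nExp (Function.update e 4 (e 4 + 1)) t = (nExp e t - delta 7) + delta 4 + delta 0 := by
  ext k; simp only [Pi.add_apply, Pi.sub_apply]; fin_cases k <;> simp [nExp, delta] <;> omega

/-- Move 5, second child. -/
theorem nExp_sub4 : nExp e (t - tUnit 4) = (nExp e t - delta 7) + delta 9 := by
  ext k; simp only [Pi.add_apply, Pi.sub_apply]; fin_cases k <;> simp [nExp, delta, tUnit] <;> omega

/-- Move 5: the parent is recovered as `(n − δ2345) + δ2345`. -/
theorem nExp_self4 : nExp e t = (nExp e t - delta 7) + delta 7 := by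
  ext k; simp only [Pi.add_apply, Pi.sub_apply]; fin_cases k <;> simp [delta]

/-- Move 5 targets (the target moves by `e₂ ↦ +1` in `r₂`). -/
theorem cExp_succ4 : cExp (Function.update e 4 (e 4 + 1)) t = cExp e t + cUnit 1 := by
  ext k; simp only [Pi.add_apply]; fin_cases k <;> simp [cExp, cUnit]; omega

/-- Move 5 targets, second child. -/
theorem cExp_sub4 : cExp e (t - tUnit 4) = cExp e t + cUnit 1 := by
  ext k; simp only [Pi.add_apply]; fin_cases k <;> simp [cExp, tUnit, cUnit]; omega

/-- Move 6 exponents. -/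
theorem nExp_succ5 : nExp (Function.update e 5 (e 5 + 1)) t = nExp e t + delta 8 := by
  ext k; simp only [Pi.add_apply]; fin_cases k <;> simp [nExp, delta]; omega

/-- Move 6, second child: `n(e+u₁+u₂, t − u₄) = n(e,t)`. -/
theorem nExp_sub5 :
    nExp (Function.update (Function.update e 0 (e 0 + 1)) 1 (e 1 + 1)) (t - tUnit 3) = nExp e t := by
  ext k; fin_cases k <;> simp [nExp, tUnit] <;> omega

/-- Move 6 targets. -/
theorem cExp_succ5 : cExp (Function.update e 5 (e 5 + 1)) t = cExp e t := by
  ext k; fin_cases k <;> simp [cExp]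

/-- Move 6 targets, second child. -/
theorem cExp_sub5 :
    cExp (Function.update (Function.update e 0 (e 0 + 1)) 1 (e 1 + 1)) (t - tUnit 3) = cExp e t - cUnit 4 := by
  ext k; simp only [Pi.sub_apply]; fin_cases k <;> simp [cExp, tUnit, cUnit]

/-- Move 7 exponents. -/
theorem nExp_succ6 : nExp (Function.update e 6 (e 6 + 1)) t = nExp e t + delta 0 + delta 3 := by
  ext k; simp only [Pi.add_apply]; fin_cases k <;> simp [nExp, delta]; omega

/-- Move 7, second child: `n(e+u₁+u₃, t − u₅) = n(e,t) + δ012`. -/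
theorem nExp_sub6 :
    nExp (Function.update (Function.update e 0 (e 0 + 1)) 2 (e 2 + 1)) (t - tUnit 4) = nExp e t + delta 1 := by
  ext k; simp only [Pi.add_apply]; fin_cases k <;> simp [nExp, delta, tUnit] <;> omega

/-- Move 7 targets. -/
theorem cExp_succ6 : cExp (Function.update e 6 (e 6 + 1)) t = cExp e t + cUnit 1 := by
  ext k; simp only [Pi.add_apply]; fin_cases k <;> simp [cExp, cUnit]; omega

/-- Move 7 targets, second child. -/
theorem cExp_sub6 :
    cExp (Function.update (Function.update e 0 (e 0 + 1)) 2 (e 2 + 1)) (t - tUnit 4) = cExp e t + cUnit 1 := by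
  ext k; simp only [Pi.add_apply]; fin_cases k <;> simp [cExp, tUnit, cUnit]; omega

end bookkeeping

/-! ## `Phi` satisfies the seven Pascal relations of `G` -/

/-- A product of variables times a series: iterated shift. -/
private theorem coeffZ_X_mul₂ (c : Fin 5 → ℤ) (i j : Fin 5) (φ : S5) :
    coeffZ c (r i * r j * φ) = coeffZ (c - cUnit i - cUnit j) φ := by
  rw [mul_assoc, coeffZ_X_mul, coeffZ_X_mul]

/-- **Move 1** (`1+v`): `Phi(e+u₁, t) = Phi(e,t) + Phi(e, t − u_v)`. -/
theorem Phi_succ0 (e : Fin 7 → ℕ) (t : Fin 5 → ℤ) :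
    Phi (Function.update e 0 (e 0 + 1)) t = Phi e t + Phi e (t - tUnit 2) := by
  have hn : nExp e t - delta 5 - delta 9 + delta 5 + delta 9 = nExp e t := by abel
  unfold Phi
  rw [nExp_succ0, cExp_succ0, E_move0, coeffZ_add, coeffZ_X_mul₂, nExp_sub0, cExp_sub0, hn]

/-- **Move 2** (`1+z`): `Phi(e+u₂, t) = Phi(e,t) + Phi(e, t − u_z)`. -/
theorem Phi_succ1 (e : Fin 7 → ℕ) (t : Fin 5 → ℤ) :
    Phi (Function.update e 1 (e 1 + 1)) t = Phi e t + Phi e (t - tUnit 0) := by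
  unfold Phi
  rw [nExp_succ1, cExp_succ1, E_move1, coeffZ_add, show ∀ φ : S5, r 0 * r 1 * r 2 * r 3 * φ =
    r 0 * r 1 * (r 2 * r 3 * φ) from fun φ => by ring, coeffZ_X_mul₂, coeffZ_X_mul₂, nExp_sub1, cExp_sub1, sub_add_cancel]

/-- **Move 3** (`1+z'`): `Phi(e+u₃, t) = Phi(e,t) + Phi(e, t − u_{z'})`. -/
theorem Phi_succ2 (e : Fin 7 → ℕ) (t : Fin 5 → ℤ) :
    Phi (Function.update e 2 (e 2 + 1)) t = Phi e t + Phi e (t - tUnit 1) := by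
  unfold Phi
  rw [nExp_succ2, cExp_succ2, E_move2, coeffZ_add, coeffZ_X_mul, nExp_sub2, cExp_sub2, sub_add_cancel]

/-- **Move 4** (`1+y`): `Phi(e+u₄, t) = Phi(e,t) + Phi(e, t − u_y)`. -/
theorem Phi_succ3 (e : Fin 7 → ℕ) (t : Fin 5 → ℤ) :
    Phi (Function.update e 3 (e 3 + 1)) t = Phi e t + Phi e (t - tUnit 3) := by
  unfold Phi
  rw [nExp_succ3, cExp_succ3, E_move3, coeffZ_add, coeffZ_X_mul, nExp_sub3, cExp_sub3, sub_add_cancel]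

/-- **Move 5** (`1+y'`): `Phi(e+u₅, t) = Phi(e,t) + Phi(e, t − u_{y'})`. -/
theorem Phi_succ4 (e : Fin 7 → ℕ) (t : Fin 5 → ℤ) :
    Phi (Function.update e 4 (e 4 + 1)) t = Phi e t + Phi e (t - tUnit 4) := by
  have hE : ((E (nExp (Function.update e 4 (e 4 + 1)) t) : S5ˣ) : S5) =
      (E (nExp e (t - tUnit 4)) : S5) + r 1 * (E (nExp e t) : S5) := by
    rw [nExp_succ4, E_move4, ← nExp_sub4, ← nExp_self4]
  have hc : cExp e t + cUnit 1 - cUnit 1 = cExp e t := by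
    ext k; simp
  unfold Phi
  rw [hE, cExp_succ4, coeffZ_add, coeffZ_X_mul, cExp_sub4, hc, add_comm]

/-- **Move 6** (`1+y(1+z)(1+v)`): `Phi(e+u₆, t) = Phi(e,t) + Phi(e+u₁+u₂, t − u_y)`. -/
theorem Phi_succ5 (e : Fin 7 → ℕ) (t : Fin 5 → ℤ) :
    Phi (Function.update e 5 (e 5 + 1)) t =
      Phi e t + Phi (Function.update (Function.update e 0 (e 0 + 1)) 1 (e 1 + 1)) (t - tUnit 3) := by
  unfold Phi
  rw [nExp_succ5, cExp_succ5, E_move5, coeffZ_add, coeffZ_X_mul, nExp_sub5, cExp_sub5]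

/-- **Move 7** (`1+y'(1+z')(1+v)`): `Phi(e+u₇, t) = Phi(e,t) + Phi(e+u₁+u₃, t − u_{y'})`. -/
theorem Phi_succ6 (e : Fin 7 → ℕ) (t : Fin 5 → ℤ) :
    Phi (Function.update e 6 (e 6 + 1)) t =
      Phi e t + Phi (Function.update (Function.update e 0 (e 0 + 1)) 2 (e 2 + 1)) (t - tUnit 4) := by
  have hc : cExp e t + cUnit 1 - cUnit 1 = cExp e t := by
    ext k; simp
  unfold Phi
  rw [nExp_succ6, cExp_succ6, E_move6, coeffZ_add, coeffZ_X_mul, nExp_sub6, cExp_sub6, hc, add_comm]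

/-! ## The base identity and the induction -/

/-- **BASE IDENTITY (INTERNALLY MINTED; cert-2 g8).**  `Phi(0,t) = [t = 0]` for every `t ∈ ℤ⁵`: the constant term of the
monomial `x(r)^{−t}` in the five cross-ratio-type coordinates `x = (z,z',v,y,y')` expressed in the gap ratios `r`, i.e.
`[r^{(t₁, t₁−t₅, t₁+t₂+t₃, t₁+t₃, t₄)}] u01^{−t₂−t₃} u0123^{t₁+t₂} u23^{t₃−t₄} u2345^{t₄+t₅} u45^{−t₁−t₃} u012345^{t₃−t₅}
= [t = 0]`.  Evidence: all `t ∈ [−2,2]⁵` (exact power-series arithmetic, seven expansion orders), and the consequence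
`G = Phi` at 1500 random points.  [evidence: HOME/cert-2/g8/DEXACT12.md] -/
@[conjecture] def DualBaseIdentity : Prop := ∀ t : Fin 5 → ℤ, Phi 0 t = if t = 0 then 1 else 0

/-- The induction potential `mu(e) = e₁+e₂+e₃+e₄+e₅+3e₆+3e₇` (every Pascal move lowers it by one). -/
def mu (e : Fin 7 → ℕ) : ℕ := e 0 + e 1 + e 2 + e 3 + e 4 + 3 * e 5 + 3 * e 6

/-- Writing `e` with `e_i ≥ 1` as a successor in slot `i`. -/
private theorem update_pred_succ (e : Fin 7 → ℕ) (i : Fin 7) (h : e i ≠ 0) :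
    Function.update (Function.update e i (e i - 1)) i (Function.update e i (e i - 1) i + 1) = e := by
  rw [Function.update_self, Function.update_idem, Nat.sub_add_cancel (Nat.one_le_iff_ne_zero.mpr h),
    Function.update_eq_self]

/-- **D-exact in twelve parameters, modulo the base identity**: `G(e,t) = Phi(e,t)` for all `e ∈ ℕ⁷`, `t ∈ ℤ⁵`. -/
theorem G_eq_Phi_of_base (hB : DualBaseIdentity) : ∀ (e : Fin 7 → ℕ) (t : Fin 5 → ℤ), G e t = Phi e t := by
  intro e
  induction' hmu : mu e using Nat.strong_induction_on with N ih generalizing e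
  intro t
  by_cases h0 : e 0 ≠ 0
  · have he := update_pred_succ e 0 h0
    set e' := Function.update e 0 (e 0 - 1) with he'
    have h' : mu e' < N := by simp [mu, he'] at hmu ⊢; omega
    rw [← he, DualQ.G_succ0, Phi_succ0, ih _ h' e' rfl, ih _ h' e' rfl]
  by_cases h1 : e 1 ≠ 0
  · have he := update_pred_succ e 1 h1
    set e' := Function.update e 1 (e 1 - 1) with he'
    have h' : mu e' < N := by simp [mu, he'] at hmu ⊢; omega
    rw [← he, DualQ.G_succ1, Phi_succ1, ih _ h' e' rfl, ih _ h' e' rfl]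
  by_cases h2 : e 2 ≠ 0
  · have he := update_pred_succ e 2 h2
    set e' := Function.update e 2 (e 2 - 1) with he'
    have h' : mu e' < N := by simp [mu, he'] at hmu ⊢; omega
    rw [← he, DualQ.G_succ2, Phi_succ2, ih _ h' e' rfl, ih _ h' e' rfl]
  by_cases h3 : e 3 ≠ 0
  · have he := update_pred_succ e 3 h3
    set e' := Function.update e 3 (e 3 - 1) with he'
    have h' : mu e' < N := by simp [mu, he'] at hmu ⊢; omega
    rw [← he, DualQ.G_succ3, Phi_succ3, ih _ h' e' rfl, ih _ h' e' rfl]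
  by_cases h4 : e 4 ≠ 0
  · have he := update_pred_succ e 4 h4
    set e' := Function.update e 4 (e 4 - 1) with he'
    have h' : mu e' < N := by simp [mu, he'] at hmu ⊢; omega
    rw [← he, DualQ.G_succ4, Phi_succ4, ih _ h' e' rfl, ih _ h' e' rfl]
  by_cases h5 : e 5 ≠ 0
  · have he := update_pred_succ e 5 h5
    set e' := Function.update e 5 (e 5 - 1) with he'
    have h' : mu e' < N := by simp [mu, he'] at hmu ⊢; omega
    have h'' : mu (Function.update (Function.update e' 0 (e' 0 + 1)) 1 (e' 1 + 1)) < N := by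
      simp [mu, he'] at hmu ⊢; omega
    rw [← he, DualQ.G_succ5, Phi_succ5, ih _ h' e' rfl, ih _ h'' _ rfl]
  by_cases h6 : e 6 ≠ 0
  · have he := update_pred_succ e 6 h6
    set e' := Function.update e 6 (e 6 - 1) with he'
    have h' : mu e' < N := by simp [mu, he'] at hmu ⊢; omega
    have h'' : mu (Function.update (Function.update e' 0 (e' 0 + 1)) 2 (e' 2 + 1)) < N := by
      simp [mu, he'] at hmu ⊢; omega
    rw [← he, DualQ.G_succ6, Phi_succ6, ih _ h' e' rfl, ih _ h'' _ rfl]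
  push Not at h0 h1 h2 h3 h4 h5 h6
  have he0 : e = 0 := by
    funext i; fin_cases i <;> simp [h0, h1, h2, h3, h4, h5, h6]
  subst he0
  rw [DualQ.G_zero, hB t]

end DualR

end Summit.KontsevichZagierPeriods.Zeta5Search.Families.Cellular
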